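import Summits.BirchSwinnertonDyer.Rank1Residual.X2.GreenbergVatsalUnramifiedAway
import Mathlib.Topology.Algebra.ClopenNhdofOne
import HarnessLib

/-!
# Unramified classes are locally trivial over `K_∞` at EVERY place `v ∤ p` — bad places included
# (the LINK `Sel ↔ S_A` at the bad `η ∤ p`; cell `b2b-bsdres`, team n1011, seat p06 GEN 5;
# OWNERS row T-A240-PORT, item K2 of the lead GEN 7's R5-65 ADDENDUM 1 (A); referee nit
# `gvSelmer-SelmerDualData-link`)

HONEST FRAMING (cell `b2b-bsdres`, run/shared/lean/b2b/bsd-rank1-residual/, verbatim in every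
file): the goal of the cell is to DELETE the COMBINATION-SHAPED residual classes of the
Birch–Swinnerton-Dyer formula for ALL analytic-rank `≤ 1` elliptic curves over `ℚ` — "full BSD
formula for every rank `≤ 1` curve in class `C`" assembled STRICTLY from published theorems — so
that the rank-`≤ 1` remainder becomes exactly the CONSTRUCTION-SHAPED classes, which are TYPED
(missing-input `Prop`s), NOT attempted. This is not "finishing BSD". Team n1011: research routes on
CONSTRUCTION-SHAPED classes (ARM α / A240 discharge); census output = EVIDENCE, never a Literature
fact; RESIDUAL-MAP marks UNCHANGED; nothing is booked by this file. THEOREMS ONLY: no definition,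
no named fact; eisenstein-p2's `X2/GreenbergVatsalUnramifiedAway`, `X2/GreenbergVatsalProPrimeToP*`
are consumed BY NAME and untouched.

## What and why

Greenberg–Vatsal (Invent. Math. 142 (2000), §2 p. 17): over `ℚ_∞` the local condition of `S_A` at a
prime `η ∤ p` is `[σ|_{I_η}] = 0`, and "`G_η/I_η` has profinite order prime to `p`. So the last
condition is equivalent to `[σ|_{I_η}] = 0`" — i.e. UNRAMIFIED = LOCALLY TRIVIAL over `K_∞` at every
`η ∤ p`, with NO reduction hypothesis.  eisenstein-p2 proved this in the kernel at the GOOD places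
(`X2.GreenbergVatsalUnramifiedAway.unramKer_le_awayKer_of_good`), using good reduction exactly once:
to know that the inertia group acts trivially on `E[p^∞]`, so that the abstract engine
`exists_eq_smul_sub_of_vanishing_on_inertia` (a cocycle of `P = Gal(K̄/K_{∞,η})` with values in an
`I`-TRIVIAL `p`-primary module, vanishing on `I`, is a coboundary — the image of `P` in every finite
quotient `D_v/(U·I_v)` having order prime to `p`) applies to `M = E[p^∞]`.

THIS FILE removes the hypothesis: at a BAD `v ∤ p` the engine is applied not to `E[p^∞]` but to the
sub-module `E[p^∞]^{I_v}` of inertia invariants — `I_v`-trivial by construction, stable under the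
decomposition group `D_v` (which normalises `I_v`), `p`-primary with finite `p^k`-torsion — viewed
as a module over the compact group `D_v` itself; a cocycle of `H ⊓ D_v` (`H = ker κ`) that is a
coboundary on `H ⊓ I_v` is first corrected by that coboundary so as to VANISH on `I_v`, and then
takes `I_v`-fixed values by the cocycle identity and the normality of `I_v` (as in the cell's
`Additive/UnramifiedKummerDoorGeneric`).

* `unramKer_le_awayKer` — for ANY number field `K`, ANY `ℤ_p`-extension `κ`, ANY finite place `v`
  unramified in `K_∞/K` (`I_v ≤ ker κ`) and not totally split (`D_v ≰ ker κ`), and `A = E[p^∞]` of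
  ANY elliptic curve (any reduction at `v`):
  `GreenbergVatsalTorsion.unramKer (ker κ) A v ≤ GreenbergSelmer.awayKer (ker κ) A v`;
  with the tree's converse `awayKer_le_unramKer`: EQUALITY `unramKer = awayKer`;
* `unramKer_le_localKerOver` — hence the classical Kummer condition
  (`X2 … awayKer_le_localKerOver`);
* `…_of_isCyclotomic` forms (`v ∤ p`; X2 §2 `inertia_le_kerSubgroup_of_isCyclotomic`,
  `not_decomp_le_kerSubgroup_of_isCyclotomic`).

References: Greenberg–Vatsal 2000 §2 p. 17 [GreenbergVatsal2000]; Greenberg, LNM 1716 §2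
pp. 69–72 [GreenbergLNM1716]; Greenberg, Adv. Stud. Pure Math. 17 (1989) p. 98 [Greenberg1989];
Neukirch *ANT* II (9.6); Serre, *Galois Cohomology* I §2.6 (b).
-/

set_option autoImplicit false

noncomputable section

open scoped Classical Pointwise

universe u

namespace Summit.BirchSwinnertonDyer.Rank1Residual.Additive

open Literature.NumberTheory.GaloisRepresentations Literature.NumberTheory.EllipticCurves
  Literature.NumberTheory.EllipticCurves.ResKernel
  Summit.BirchSwinnertonDyer.Rank1Residual.X2.GreenbergVatsalProPrimeToP
  Summit.BirchSwinnertonDyer.Rank1Residual.X2.GreenbergVatsalProPrimeToPCocycle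
  Summit.BirchSwinnertonDyer.Rank1Residual.X2.GreenbergVatsalUnramifiedAway
  NumberField IsDedekindDomain Field Literature.NumberTheory.EllipticCurves.GreenbergSelmer
  Summit.BirchSwinnertonDyer.Rank1Residual.X2.GreenbergVatsalTorsion
  Summit.BirchSwinnertonDyer.Rank1Residual.X2.GreenbergVatsalTorsionCurve

section AnyPlace

variable {K : Type u} [Field K] [NumberField K] {p : ℕ} [Fact p.Prime] (κ : ZpExtension K p)
  (v : HeightOneSpectrum (𝓞 K))

variable (W : WeierstrassCurve K) [W.IsElliptic] (p)

/-- **Unramified ⇒ locally trivial over `K_∞` at EVERY `v` unramified and not totally split in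
`K_∞/K`** (GV p. 17: "`G_η/I_η` has profinite order prime to `p`"), for `A = E[p^∞]` of any
elliptic curve with ANY reduction type at `v`: a class of `H¹(K_∞, E[p^∞])` that dies on `H ⊓ I_v`
(`GreenbergVatsalTorsion.unramKer`) dies on `H ⊓ D_v` (`GreenbergSelmer.awayKer`).  The engine
`exists_eq_smul_sub_of_vanishing_on_inertia` is run over the compact group `D_v` on the
`I_v`-invariants `E[p^∞]^{I_v}`, after correcting the cocycle by the coboundary that kills it on
`I_v`. [cite: GreenbergVatsal2000, §2 p. 17] [cite: GreenbergLNM1716, §2 pp. 69–72] -/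
theorem unramKer_le_awayKer (hI : inertia v ≤ κ.kerSubgroup) (hD : ¬ decomp v ≤ κ.kerSubgroup) :
    unramKer κ.kerSubgroup (W.geomPrimaryTorsion p) v ≤
      awayKer κ.kerSubgroup (W.geomPrimaryTorsion p) v := by
  intro c hc
  obtain ⟨f, rfl⟩ :=
    oneCocycleClass_surjective (discreteTopRep κ.kerSubgroup (W.geomPrimaryTorsion p)) c
  obtain ⟨m, hm⟩ :=
    (X2.GreenbergVatsalSelmerLink.oneCocycleClass_mem_unramKer_iff κ.kerSubgroup _ v f).1 hc
  rw [awayKer, AddMonoidHom.mem_ker, resOfLe_oneCocycleClass_eq_zero_iff κ.kerSubgroup]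
  -- (`Γ = absoluteGaloisGroup K`, `M = E[p^∞]`, `H = ker κ`, `D = D_v`, `I = I_v`, `P = H ⊓ D`)
  have hPH : κ.kerSubgroup ⊓ decomp v ≤ κ.kerSubgroup := inf_le_left
  haveI : CompactSpace (absoluteGaloisGroup K) := absoluteGaloisGroup_compactSpace K
  -- the dictionary with `𝔓₀ = adicCompletionPrime K v`, a Frobenius `φ ∈ D_v`
  have hDeq :
      decomp v = (adicCompletionPrime K v).decompositionSubgroup (absoluteGaloisGroup K) :=
    (decompositionSubgroup_adicCompletionPrime_eq_range K v).symm
  have hIeq : (inertia v) = (adicCompletionPrime K v).inertia (absoluteGaloisGroup K) :=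
    (inertia_adicCompletionPrime_eq_map_absInertia K v).symm
  obtain ⟨φ, hφ⟩ :=
    IsDedekindDomain.HeightOneSpectrum.exists_isArithFrobAt_of_mem_primesAbove_holds (K := K)
      (v := v) (adicCompletionPrime_mem_primesAbove K v)
  haveI := (adicCompletionPrime_isMaximal K v).isPrime
  have hφD : φ ∈ decomp v := by rw [hDeq]; exact hφ.mem_stabilizer
  have hIn : ∀ g ∈ decomp v, ∀ i ∈ inertia v, g * i * g⁻¹ ∈ inertia v := fun g hg i hi ↦ by
    rw [hIeq] at hi ⊢; rw [hDeq] at hg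
    exact conj_mem_inertia_of_mem_decompositionSubgroup _ hg hi
  have hID : (inertia v) ≤ (decomp v) := inertia_le_decomp v
  have hDclosed : IsClosed ((decomp v) : Set (absoluteGaloisGroup K)) := by
    rw [hDeq]
    exact absIntegers.isClosed_decompositionSubgroup_holds (R := 𝓞 K) (adicCompletionPrime K v)
  -- the sub-module of inertia invariants, a module over the compact group `D_v`
  let Mfix : AddSubgroup ↥(W.geomPrimaryTorsion p) :=
    { carrier := {x | ∀ i ∈ inertia v, i • x = x}
      zero_mem' := fun i _ ↦ smul_zero i
      add_mem' := fun {a b} ha hb i hi ↦ by rw [smul_add, ha i hi, hb i hi]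
      neg_mem' := fun {a} ha i hi ↦ by rw [smul_neg, ha i hi] }
  have hstab : ∀ (d : absoluteGaloisGroup K), d ∈ decomp v → ∀ x ∈ Mfix, d • x ∈ Mfix := by
    intro d hd x hx i hi
    have h1 : d⁻¹ * i * d⁻¹⁻¹ ∈ inertia v := hIn d⁻¹ ((decomp v).inv_mem hd) i hi
    rw [inv_inv] at h1
    have h2 := hx _ h1
    rw [mul_smul, mul_smul] at h2
    -- `d⁻¹ • i • d • x = x` ⟹ `i • d • x = d • x`
    have h3 := congrArg (fun y ↦ d • y) h2
    simp only [smul_inv_smul] at h3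
    exact h3
  letI instSMul : SMul (↥(decomp v)) (↥Mfix) :=
    ⟨fun d x ↦ ⟨(d : absoluteGaloisGroup K) • (x : W.geomPrimaryTorsion p), hstab d d.2 x x.2⟩⟩
  have hsmul_def : ∀ (d : ↥(decomp v)) (x : ↥Mfix), ((d • x : ↥Mfix) : ↥(W.geomPrimaryTorsion p)) =
      (d : absoluteGaloisGroup K) • (x : W.geomPrimaryTorsion p) :=
    fun _ _ ↦ rfl
  letI instAction : DistribMulAction (↥(decomp v)) (↥Mfix) :=
    { one_smul := fun x ↦ Subtype.ext (by
        rw [hsmul_def]; exact one_smul (absoluteGaloisGroup K) (x : W.geomPrimaryTorsion p))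
      mul_smul := fun a b x ↦ Subtype.ext (by
        rw [hsmul_def, hsmul_def, hsmul_def]
        exact mul_smul (a : absoluteGaloisGroup K) (b : absoluteGaloisGroup K)
          (x : W.geomPrimaryTorsion p))
      smul_zero := fun a ↦ Subtype.ext (by
        rw [hsmul_def]; exact smul_zero (a : absoluteGaloisGroup K))
      smul_add := fun a x y ↦ Subtype.ext (by
        rw [hsmul_def]
        exact smul_add (a : absoluteGaloisGroup K) (x : W.geomPrimaryTorsion p)
          (y : W.geomPrimaryTorsion p)) }
  haveI : CompactSpace (↥(decomp v)) := isCompact_iff_compactSpace.mp hDclosed.isCompact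
  -- the data of the engine over `Γ' = D_v`
  let I' : Subgroup (↥(decomp v)) := (inertia v).subgroupOf (decomp v)
  let P' : Subgroup (↥(decomp v)) := (κ.kerSubgroup ⊓ decomp v).subgroupOf (decomp v)
  let φ' : ↥(decomp v) := ⟨φ, hφD⟩
  let κ' : ↥(decomp v) →* Multiplicative ℤ_[p] :=
    κ.toContinuousMonoidHom.toMonoidHom.comp (decomp v).subtype
  have hκ' : ∀ d : ↥(decomp v), κ' d = κ (d : absoluteGaloisGroup K) := fun _ ↦ rfl
  -- the corrected cocycle on `P = κ.kerSubgroup ⊓ D_v`: `f₁ = f|_P − ∂m`, which vanishes on `I_v`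
  let ι : ↥P' → ↥(κ.kerSubgroup ⊓ decomp v) := fun x ↦
    ⟨((x : ↥(decomp v)) : absoluteGaloisGroup K), Subgroup.mem_subgroupOf.mp x.2⟩
  have hιcont : Continuous ι :=
    (continuous_subtype_val.comp continuous_subtype_val).subtype_mk _
  let f₀ : ↥(κ.kerSubgroup ⊓ decomp v) → ↥(W.geomPrimaryTorsion p) := fun σ ↦
    f.1 (subgroupInclusion hPH σ) - ((σ : absoluteGaloisGroup K) • m - m)
  have hf₀cont : Continuous f₀ :=
    (f.1.continuous.comp (subgroupInclusion hPH).continuous).sub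
      (((W.continuous_smul_geomPrimaryTorsion p m).comp continuous_subtype_val).sub
        continuous_const)
  have hf₀coc : ∀ a b : ↥(κ.kerSubgroup ⊓ decomp v),
      f₀ (a * b) = f₀ a + (a : absoluteGaloisGroup K) • f₀ b := by
    intro a b
    have h := f.2 (subgroupInclusion hPH a)
      (subgroupInclusion hPH b)
    rw [← map_mul] at h
    change f.1 (subgroupInclusion _ (a * b)) =
      f.1 (subgroupInclusion _ a) + (a : absoluteGaloisGroup K) • f.1 (subgroupInclusion _ b) at h
    simp only [f₀, h, Subgroup.coe_mul, mul_smul, smul_sub]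
    abel
  -- `f₀` vanishes on `I_v` (the unramified hypothesis `hm`)
  have hf₀I : ∀ σ : ↥(κ.kerSubgroup ⊓ decomp v),
      (σ : absoluteGaloisGroup K) ∈ inertia v → f₀ σ = 0 := by
    intro σ hσI
    have hσH : (σ : absoluteGaloisGroup K) ∈ κ.kerSubgroup := (Subgroup.mem_inf.1 σ.2).1
    have hσD : (σ : absoluteGaloisGroup K) ∈ decomp v := (Subgroup.mem_inf.1 σ.2).2
    let x' : inertiaIn κ.kerSubgroup v :=
      ⟨⟨σ, hσD⟩, (mem_inertiaIn_iff κ.kerSubgroup v _).2 ⟨hσH, hσI⟩⟩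
    have h := hm x'
    have e1 : inertiaInToH κ.kerSubgroup v x' = subgroupInclusion hPH σ :=
      Subtype.ext rfl
    rw [e1] at h
    change f.1 (subgroupInclusion _ σ) - ((σ : absoluteGaloisGroup K) • m - m) = 0
    rw [h]
    exact sub_eq_zero.mpr rfl
  -- hence `f₀` takes `I_v`-fixed values (cocycle identity; `I_v ⊴ D_v`, `I_v ≤ H ⊓ D_v`)
  have hf₀fix : ∀ σ : ↥(κ.kerSubgroup ⊓ decomp v), f₀ σ ∈ Mfix := by
    intro σ i hi
    have hiP : i ∈ κ.kerSubgroup ⊓ decomp v := Subgroup.mem_inf.2 ⟨hI hi, hID hi⟩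
    -- `τ' = σ⁻¹ i σ ∈ I_v`, `i σ = σ τ'`
    have hσD : (σ : absoluteGaloisGroup K) ∈ decomp v := (Subgroup.mem_inf.1 σ.2).2
    have hτ' : (σ : absoluteGaloisGroup K)⁻¹ * i * (σ : absoluteGaloisGroup K) ∈ inertia v := by
      have h := hIn _ ((decomp v).inv_mem hσD) i hi
      rwa [inv_inv] at h
    have hτ'P : (σ : absoluteGaloisGroup K)⁻¹ * i * (σ : absoluteGaloisGroup K) ∈
        κ.kerSubgroup ⊓ decomp v := Subgroup.mem_inf.2 ⟨hI hτ', hID hτ'⟩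
    have e1 := hf₀coc ⟨i, hiP⟩ σ
    have e2 := hf₀coc σ ⟨_, hτ'P⟩
    have hmul : (⟨i, hiP⟩ : ↥(κ.kerSubgroup ⊓ decomp v)) * σ = σ * ⟨_, hτ'P⟩ := by
      apply Subtype.ext
      change i * (σ : absoluteGaloisGroup K) =
        (σ : absoluteGaloisGroup K) *
          ((σ : absoluteGaloisGroup K)⁻¹ * i * (σ : absoluteGaloisGroup K))
      simp only [← mul_assoc, mul_inv_cancel, one_mul]
    rw [hmul, e2, hf₀I ⟨_, hτ'P⟩ hτ', smul_zero, add_zero, hf₀I ⟨i, hiP⟩ hi, zero_add] at e1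
    exact e1.symm
  -- the cocycle `g'` of `P' ≤ D_v` with values in `Mfix`
  let g₁ : ↥P' → ↥Mfix := fun x ↦ ⟨f₀ (ι x), hf₀fix (ι x)⟩
  have hg₁cont : Continuous g₁ :=
    ((hf₀cont.comp hιcont : Continuous fun x ↦ f₀ (ι x))).subtype_mk _
  have hg₁val : ∀ x : ↥P', ((g₁ x : ↥Mfix) : ↥(W.geomPrimaryTorsion p)) = f₀ (ι x) := fun _ ↦ rfl
  let g' : contOneCocycles (discreteTopRep (↥P') (↥Mfix)) :=
    ⟨⟨g₁, hg₁cont⟩, fun a b ↦ by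
      apply Subtype.ext
      change ((g₁ (a * b) : ↥Mfix) : ↥(W.geomPrimaryTorsion p)) =
        ((g₁ a + ((a : ↥(decomp v)) • g₁ b : ↥Mfix) : ↥Mfix) : ↥(W.geomPrimaryTorsion p))
      rw [AddSubgroup.coe_add, hsmul_def, hg₁val, hg₁val, hg₁val]
      have hab : ι (a * b) = ι a * ι b := Subtype.ext rfl
      rw [hab, hf₀coc]⟩
  -- run the engine over `D_v`
  haveI : TotallyDisconnectedSpace (absoluteGaloisGroup K) :=
    inferInstanceAs (TotallyDisconnectedSpace (AlgebraicClosure K ≃ₐ[K] AlgebraicClosure K))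
  obtain ⟨b, hb⟩ := exists_eq_smul_sub_of_vanishing_on_inertia (Γ := ↥(decomp v)) (M := ↥Mfix)
    (G := (⊤ : Subgroup ↥(decomp v))) (I := I') (φ := φ') (κ := κ') (P := P')
    le_top
    (fun g _ i hi ↦ by
      rw [Subgroup.mem_subgroupOf] at hi ⊢
      simpa only [Subgroup.coe_mul, Subgroup.coe_inv] using hIn _ g.2 _ hi)
    (Subgroup.mem_top _)
    (fun U hU d _ ↦ by
      -- an open normal subgroup `N ≤ (absoluteGaloisGroup K)` with `N ∩ (decomp v) ⊆ U`
      obtain ⟨O, hO, hOU⟩ := isOpen_induced_iff.mp hU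
      have h1O : (1 : absoluteGaloisGroup K) ∈ O := by
        have : (1 : ↥(decomp v)) ∈ (Subtype.val ⁻¹' O : Set ↥(decomp v)) := by
          rw [hOU]; exact U.one_mem
        exact this
      obtain ⟨N, hN⟩ := ProfiniteGrp.exist_openNormalSubgroup_sub_open_nhds_of_one hO h1O
      have hd : (d : absoluteGaloisGroup K) ∈
          (adicCompletionPrime K v).decompositionSubgroup (absoluteGaloisGroup K) := hDeq ▸ d.2
      obtain ⟨n, i, w, hi, hw, hdec⟩ := exists_eq_frobenius_pow_mul_of_mem_decompositionSubgroup
        (adicCompletionPrime_mem_primesAbove K v) hφ N.isOpen hd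
      have hiI : i ∈ inertia v := hIeq ▸ hi
      have hiD : i ∈ decomp v := hID hiI
      have hwD : w ∈ decomp v := by
        have e : w = (φ ^ n * i)⁻¹ * (d : absoluteGaloisGroup K) := by
          rw [hdec, inv_mul_cancel_left]
        rw [e]
        exact (decomp v).mul_mem
          ((decomp v).inv_mem ((decomp v).mul_mem ((decomp v).pow_mem hφD n) hiD)) d.2
      refine ⟨n, ⟨i, hiD⟩, ⟨w, hwD⟩, Subgroup.mem_subgroupOf.mpr hiI, ?_, Subtype.ext ?_⟩
      · have : (⟨w, hwD⟩ : ↥(decomp v)) ∈ (Subtype.val ⁻¹' O : Set ↥(decomp v)) := hN hw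
        rw [hOU] at this
        exact this
      · simpa only [Subgroup.coe_mul, Subgroup.coe_pow] using hdec)
    (fun i hi ↦ by
      rw [hκ']
      exact ZpExtension.mem_kerSubgroup.mp (hI (Subgroup.mem_subgroupOf.mp hi)))
    (by rw [hκ']; exact kappa_frob_ne_one κ v hφ hI hD)
    (fun B ↦ ⟨(κ.layerSubgroup B).subgroupOf (decomp v),
      (κ.isOpen_layerSubgroup B).preimage continuous_subtype_val,
      fun x hx ↦ ZpExtension.mem_layerSubgroup.mp (Subgroup.mem_subgroupOf.mp hx)⟩)
    (fun {x} ↦ by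
      rw [Subgroup.mem_subgroupOf, Subgroup.mem_inf, hκ', ZpExtension.mem_kerSubgroup]
      exact ⟨fun h ↦ ⟨h.1, Subgroup.mem_top _⟩, fun h ↦ ⟨h.1, x.2⟩⟩)
    (by
      change IsClosed (Subtype.val ⁻¹'
        ((κ.kerSubgroup ⊓ decomp v : Subgroup (absoluteGaloisGroup K)) :
          Set (absoluteGaloisGroup K)) : Set ↥(decomp v))
      exact (κ.isClosed_kerSubgroup.inter hDclosed).preimage continuous_subtype_val)
    (fun x ↦ (((W.continuous_smul_geomPrimaryTorsion p (x : W.geomPrimaryTorsion p)).comp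
      continuous_subtype_val).subtype_mk _ : Continuous fun d : ↥(decomp v) ↦ d • x))
    (fun x ↦ by
      obtain ⟨k, hk⟩ := (AddCommGroup.mem_primaryComponent).1 (x : W.geomPrimaryTorsion p).2
      refine ⟨k, Subtype.ext (Subtype.ext ?_)⟩
      rw [AddSubgroupClass.coe_nsmul, AddSubmonoidClass.coe_nsmul, ZeroMemClass.coe_zero,
        ZeroMemClass.coe_zero]
      exact hk)
    (fun k ↦ by
      haveI := W.finite_torsionBy_geomPrimaryTorsion p k
      have e : {x : ↥Mfix | p ^ k • x = 0} =
          Subtype.val ⁻¹'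
            ((AddSubgroup.torsionBy ↥(W.geomPrimaryTorsion p) (p ^ k : ℕ) :
              AddSubgroup ↥(W.geomPrimaryTorsion p)) : Set ↥(W.geomPrimaryTorsion p)) := by
        ext x
        rw [Set.mem_setOf_eq, Set.mem_preimage, SetLike.mem_coe, AddSubgroup.torsionBy.nsmul_iff,
          ← AddSubgroupClass.coe_nsmul]
        exact ⟨fun h ↦ by rw [h]; rfl, fun h ↦ Subtype.ext h⟩
      rw [e]
      exact (Set.toFinite _).preimage Subtype.val_injective.injOn)
    (fun i hi x ↦ Subtype.ext (by rw [hsmul_def]; exact x.2 _ (Subgroup.mem_subgroupOf.mp hi)))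
    g'
    (fun x hxI ↦ by
      apply Subtype.ext
      change f₀ (ι x) = ((0 : ↥Mfix) : ↥(W.geomPrimaryTorsion p))
      rw [ZeroMemClass.coe_zero]
      exact hf₀I (ι x) (Subgroup.mem_subgroupOf.mp hxI))
  -- read off: `f|_P = ∂(b + m)`
  refine ⟨(b : W.geomPrimaryTorsion p) + m, fun σ ↦ ?_⟩
  have hσ : (⟨(σ : absoluteGaloisGroup K), (Subgroup.mem_inf.1 σ.2).2⟩ : ↥(decomp v)) ∈ P' :=
    Subgroup.mem_subgroupOf.mpr σ.2
  have h := congrArg (fun y : ↥Mfix ↦ (y : W.geomPrimaryTorsion p)) (hb ⟨_, hσ⟩)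
  change f₀ (ι ⟨_, hσ⟩) = (((⟨_, hσ⟩ : ↥P') : ↥(decomp v)) • b - b : ↥Mfix) at h
  rw [AddSubgroupClass.coe_sub, hsmul_def] at h
  have hισ : ι ⟨_, hσ⟩ = σ := Subtype.ext rfl
  rw [hισ] at h
  -- `f₀ σ = f σ − (σ m − m)`
  have e : f.1 (subgroupInclusion hPH σ) =
      f₀ σ + ((σ : absoluteGaloisGroup K) • m - m) := by
    simp only [f₀, sub_add_cancel]
  rw [e, h, smul_add]
  change (σ : absoluteGaloisGroup K) • (b : W.geomPrimaryTorsion p) - b +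
      ((σ : absoluteGaloisGroup K) • m - m) =
    (σ : absoluteGaloisGroup K) • (b : W.geomPrimaryTorsion p) + (σ : absoluteGaloisGroup K) • m -
      ((b : W.geomPrimaryTorsion p) + m)
  abel

/-- **Equality of the two local conditions over `K_∞` at `v`** (unramified in `K_∞/K`, not totally
split): GV's "unramified at `η`" (`unramKer`) and Greenberg's "trivial at `η`" (`awayKer`) coincide
on `H¹(K_∞, E[p^∞])`, any reduction type. [cite: GreenbergVatsal2000, §2 p. 17] -/
theorem unramKer_eq_awayKer (hI : inertia v ≤ κ.kerSubgroup) (hD : ¬ decomp v ≤ κ.kerSubgroup) :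
    unramKer κ.kerSubgroup (W.geomPrimaryTorsion p) v =
      awayKer κ.kerSubgroup (W.geomPrimaryTorsion p) v :=
  le_antisymm (unramKer_le_awayKer (κ := κ) (v := v) (W := W) (p := p) hI hD)
    (awayKer_le_unramKer (H := κ.kerSubgroup) (M := W.geomPrimaryTorsion p) v)

/-- **Unramified ⇒ the classical local condition over `K_∞`** at `v` (unramified, not totally split
in `K_∞/K`; any reduction): a class of `H¹(K_∞, E[p^∞])` dying on `H ⊓ I_v` dies in
`H¹(H_{K_v}, E(K̄_v))` (`WeierstrassCurve.localKerOver`). [cite: GreenbergVatsal2000, §2 p. 17]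
[cite: GreenbergLNM1716, §2 pp. 69–72] -/
theorem unramKer_le_localKerOver (hI : inertia v ≤ κ.kerSubgroup)
    (hD : ¬ decomp v ≤ κ.kerSubgroup) :
    unramKer κ.kerSubgroup (W.geomPrimaryTorsion p) v ≤
      W.localKerOver p κ.kerSubgroup (v.adicCompletion K) :=
  (unramKer_le_awayKer (κ := κ) (v := v) (W := W) (p := p) hI hD).trans
    (awayKer_le_localKerOver (v := v) (W := W) (p := p) κ.kerSubgroup)

end AnyPlace

/-! ## The cyclotomic tower (X2 §2 is stated over `K : Type`) -/

section Cyclotomic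

variable {K : Type} [Field K] [NumberField K] {p : ℕ} [Fact p.Prime] (κ : ZpExtension K p)
  (v : HeightOneSpectrum (𝓞 K))

variable (W : WeierstrassCurve K) [W.IsElliptic] (p)

/-- **The cyclotomic tower, any `v ∤ p`, any reduction: `unramKer = awayKer`** (`I_v ≤ ker κ` and
`D_v ≰ ker κ` are automatic, X2 §2). [cite: GreenbergVatsal2000, §2 p. 17]
[cite: Washington1997, §13.1] -/
theorem unramKer_eq_awayKer_of_isCyclotomic (hκ : κ.IsCyclotomic)
    (hpv : ((p : ℕ) : 𝓞 K) ∉ v.asIdeal) :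
    unramKer κ.kerSubgroup (W.geomPrimaryTorsion p) v =
      awayKer κ.kerSubgroup (W.geomPrimaryTorsion p) v :=
  unramKer_eq_awayKer (κ := κ) (v := v) (W := W) (p := p)
    (inertia_le_kerSubgroup_of_isCyclotomic κ v hκ hpv)
    (not_decomp_le_kerSubgroup_of_isCyclotomic κ v hκ hpv)

/-- **The cyclotomic tower, any `v ∤ p`, any reduction: unramified ⇒ the classical local
condition.** [cite: GreenbergVatsal2000, §2 p. 17] [cite: GreenbergLNM1716, §2 pp. 69–72] -/
theorem unramKer_le_localKerOver_of_isCyclotomic (hκ : κ.IsCyclotomic)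
    (hpv : ((p : ℕ) : 𝓞 K) ∉ v.asIdeal) :
    unramKer κ.kerSubgroup (W.geomPrimaryTorsion p) v ≤
      W.localKerOver p κ.kerSubgroup (v.adicCompletion K) :=
  unramKer_le_localKerOver (κ := κ) (v := v) (W := W) (p := p)
    (inertia_le_kerSubgroup_of_isCyclotomic κ v hκ hpv)
    (not_decomp_le_kerSubgroup_of_isCyclotomic κ v hκ hpv)

end Cyclotomic

end Summit.BirchSwinnertonDyer.Rank1Residual.Additive

end
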